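import Summits.ResolutionOfSingularities.ResolutionOfSingularities.Theorems.FrobeniusLadderFRationalResolutionQuadricConeResolution
import Summits.ResolutionOfSingularities.ResolutionOfSingularities.Theorems.FrobeniusLadderFRationalResolutionChartGraphCube
import Summits.ResolutionOfSingularities.ResolutionOfSingularities.Theorems.FrobeniusLadderFRationalResolutionChartElimCube
import HarnessLib

/-!
# Rung 4′ at the `A₂` surface singularity `yz + x³ = 0`, resolved by one blowing up

Support file for crux stmt-ResolutionOfSingularities-15317 (`FrobeniusLadder.FRationalResolution`),
line `Sketch`, continuation seat c2, wave 2. The suspension `Σ(x³) = Spec k[y,z,x]/(yz + x³)` (the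
`A₂` singularity, singular at the origin, in the residual class by the calibration) is resolved for
every field `k` by ONE blowing up of the origin: the `y`/`z`-charts are graph charts `≅ k[Y, X']`
(`stub_chart_graph_cube`), the `x`-chart is the elimination chart `≅ k[Y', Z']`, `x = −Y'Z'`
(`stub_chart_elim_cube`).

* `hasResolution_coneCube`, `coneCube_singular_hasResolution`.
-/

-- single-problem summit: the doubled namespace component `ResolutionOfSingularities` is forced
set_option linter.dupNamespace false

noncomputable section

open CategoryTheory AlgebraicGeometry TopologicalSpace
open Literature.AlgebraicGeometry.Resolution Literature.RingTheory.TightClosure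

namespace Summit.ResolutionOfSingularities.ResolutionOfSingularities.Theorems.FRationalResolution

section ConeCube

open MvPolynomial

variable (k : Type) [Field k]

/-- **The `A₂` surface singularity `{yz + x³ = 0}` has a resolution of singularities, for every
field `k`**: the blowing up of the singular point `I = (y, z, x)` is regular — the `y`- and
`z`-charts are graph charts `≅ k[Y, X']` (`stub_chart_graph_cube`), the `x`-chart is the elimination
chart `R[I/x] ≅ k[Y', Z']`, `x = −Y'Z'` (`stub_chart_elim_cube`) — and `affineBlowup.isResolution`
applies. (`A₁ = Σ(x²)` is `hasResolution_quadricCone`; `A_m`, `m ≥ 3`, needs iterated blow-ups.) -/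
theorem hasResolution_coneCube :
    Scheme.HasResolution (Spec (CommRingCat.of (MvPolynomial (Fin 2 ⊕ Fin 1) k ⧸ Ideal.span
      {(MvPolynomial.X (Sum.inl 0) * MvPolynomial.X (Sum.inl 1) +
        MvPolynomial.rename Sum.inr (MvPolynomial.X 0 ^ 3) : MvPolynomial (Fin 2 ⊕ Fin 1) k)}))) := by
  set g : MvPolynomial (Fin 2 ⊕ Fin 1) k :=
    X (Sum.inl 0) * X (Sum.inl 1) + rename Sum.inr (X 0 ^ 3) with hg
  haveI hprime : (Ideal.span {g}).IsPrime :=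
    isPrime_span_suspension k 1 (X 0 ^ 3) (pow_ne_zero _ (X_ne_zero 0))
  haveI : IsDomain (MvPolynomial (Fin 2 ⊕ Fin 1) k ⧸ Ideal.span {g}) := Ideal.Quotient.isDomain _
  set mk : MvPolynomial (Fin 2 ⊕ Fin 1) k →ₐ[k] MvPolynomial (Fin 2 ⊕ Fin 1) k ⧸ Ideal.span {g} :=
    Ideal.Quotient.mkₐ k (Ideal.span {g}) with hmk
  set xb := mk (X (Sum.inr 0)) with hxb
  set yb := mk (X (Sum.inl 0)) with hyb
  set zb := mk (X (Sum.inl 1)) with hzb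
  have hrel : yb * zb + xb ^ 3 = 0 := by
    have : mk g = 0 := by
      rw [hmk, Ideal.Quotient.mkₐ_eq_mk, Ideal.Quotient.eq_zero_iff_mem]
      exact Ideal.mem_span_singleton_self g
    simpa [hg, map_add, map_mul, map_pow, rename_X] using this
  have hrel' : zb * yb + xb ^ 3 = 0 := by rw [mul_comm]; exact hrel
  have hgen : Algebra.adjoin k {xb, yb, zb} = ⊤ := adjoin_mk_X_eq_top k g
  have hgen' : Algebra.adjoin k {xb, zb, yb} = ⊤ := by
    rw [← hgen]; congr 1; ext q; simp only [Set.mem_insert_iff, Set.mem_singleton_iff]; tauto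
  -- test maps into an arbitrary target
  have key : ∀ (L : Type) [CommRing L] [Algebra k L] (F : Fin 2 ⊕ Fin 1 → L),
      F (Sum.inl 0) * F (Sum.inl 1) + F (Sum.inr 0) ^ 3 = 0 →
      ∃ θ : (MvPolynomial (Fin 2 ⊕ Fin 1) k ⧸ Ideal.span {g}) →ₐ[k] L,
        θ yb = F (Sum.inl 0) ∧ θ zb = F (Sum.inl 1) ∧ θ xb = F (Sum.inr 0) := by
    intro L _ _ F hF
    have hlift : ∀ (θ₀ : MvPolynomial (Fin 2 ⊕ Fin 1) k →ₐ[k] L), θ₀ g = 0 →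
        ∀ s ∈ Ideal.span {g}, θ₀ s = 0 := by
      intro θ₀ h0 s hs
      obtain ⟨r, rfl⟩ := Ideal.mem_span_singleton'.mp hs
      rw [map_mul, h0, mul_zero]
    have h0 : aeval F g = 0 := by
      rw [hg, map_add, map_mul, aeval_X, aeval_X, aeval_rename, map_pow, aeval_X]
      exact hF
    refine ⟨Ideal.Quotient.liftₐ (Ideal.span {g}) (aeval F) (hlift _ h0), ?_, ?_, ?_⟩
    all_goals
      exact (AlgHom.congr_fun (Ideal.Quotient.liftₐ_comp (Ideal.span {g}) (aeval F) (hlift _ h0))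
        (X _)).trans (aeval_X F _)
  set u₀ := algebraMap (MvPolynomial (Fin 2) k)
    (Localization.Away (MvPolynomial.X 0 : MvPolynomial (Fin 2) k)) (X 0) with hu₀
  set u₁ := algebraMap (MvPolynomial (Fin 2) k)
    (Localization.Away (MvPolynomial.X 0 : MvPolynomial (Fin 2) k)) (X 1) with hu₁
  set w₀ := algebraMap (MvPolynomial (Fin 2) k)
    (Localization.Away (MvPolynomial.X 0 * MvPolynomial.X 1 : MvPolynomial (Fin 2) k)) (X 0)
    with hw₀
  set w₁ := algebraMap (MvPolynomial (Fin 2) k)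
    (Localization.Away (MvPolynomial.X 0 * MvPolynomial.X 1 : MvPolynomial (Fin 2) k)) (X 1)
    with hw₁
  -- chart y
  have hBy : IsRegularRing (blowupAlgebra (Ideal.span {xb, yb, zb}) yb) := by
    obtain ⟨θ, h1, h2, h3⟩ := key _ (Sum.elim ![u₀, -(u₁ ^ 3 * u₀ ^ 2)] ![u₁ * u₀])
      (by simp; ring)
    refine stub_chart_graph_cube k _ xb yb zb hrel hgen θ ?_ ?_ ?_
    · rw [h1]; rfl
    · rw [h3, map_mul]; rfl
    · rw [h2, map_mul, map_pow, map_pow]; rfl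
  -- chart z
  have hBz : IsRegularRing (blowupAlgebra (Ideal.span {xb, yb, zb}) zb) := by
    obtain ⟨θ, h1, h2, h3⟩ := key _ (Sum.elim ![-(u₁ ^ 3 * u₀ ^ 2), u₀] ![u₁ * u₀])
      (by simp; ring)
    have h := stub_chart_graph_cube k _ xb zb yb hrel' hgen' θ ?_ ?_ ?_
    · have hset : ({xb, zb, yb} : Set (MvPolynomial (Fin 2 ⊕ Fin 1) k ⧸ Ideal.span {g})) =
          {xb, yb, zb} := by
        ext q; simp only [Set.mem_insert_iff, Set.mem_singleton_iff]; tauto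
      rwa [hset] at h
    · rw [h2]; rfl
    · rw [h3, map_mul]; rfl
    · rw [h1, map_mul, map_pow, map_pow]; rfl
  -- chart x
  have hBx : IsRegularRing (blowupAlgebra (Ideal.span {xb, yb, zb}) xb) := by
    obtain ⟨θ, h1, h2, h3⟩ := key _ (Sum.elim ![-(w₀ ^ 2 * w₁), -(w₀ * w₁ ^ 2)] ![-(w₀ * w₁)])
      (by simp; ring)
    refine stub_chart_elim_cube k _ xb yb zb hrel hgen θ ?_ ?_ ?_
    · rw [h3, map_mul]; rfl
    · rw [h1, map_mul, map_pow]; rfl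
    · rw [h2, map_mul, map_pow]; rfl
  -- the centre as a family and the chart cover
  set v : Fin 3 → MvPolynomial (Fin 2 ⊕ Fin 1) k ⧸ Ideal.span {g} := ![yb, zb, xb] with hv
  have hIv : Ideal.span (Set.range v) = Ideal.span {xb, yb, zb} := by
    congr 1
    ext q
    simp only [hv, Matrix.range_cons, Matrix.range_empty, Set.union_empty, Set.union_singleton,
      Set.mem_insert_iff, Set.mem_singleton_iff, Set.mem_union]
    tauto
  have hreg : Scheme.IsRegular (affineBlowup (Ideal.span (Set.range v))) := by
    refine Scheme.IsRegular.of_forall_exists_isOpenImmersion fun p => ?_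
    have hp : p ∈ (⨆ i : Fin 3, Proj.basicOpen (reesGrading (Ideal.span (Set.range v)))
        (reesT (v i) (Ideal.mem_span_range_self (f := v) (x := i)))) := by
      rw [affineBlowup.iSup_basicOpen_reesT_generators_eq_top v]; trivial
    obtain ⟨i, hi⟩ := Opens.mem_iSup.mp hp
    have hB : IsRegularRing (blowupAlgebra (Ideal.span (Set.range v)) (v i)) := by
      rw [hIv]
      fin_cases i
      · exact hBy
      · exact hBz
      · exact hBx
    haveI := hB
    haveI : IsRegularRing (CommRingCat.of (HomogeneousLocalization.Away
        (reesGrading (Ideal.span (Set.range v)))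
        (reesT (v i) (Ideal.mem_span_range_self (f := v) (x := i))))) :=
      IsRegularRing.of_ringEquiv (reesChartEquiv (v i) _).symm
    refine ⟨_, Proj.awayι (reesGrading (Ideal.span (Set.range v))) (reesT (v i) _) (reesT_mem (v i) _)
      Nat.one_pos, inferInstance, ?_, Scheme.isRegular_Spec _⟩
    rw [← Scheme.Hom.coe_opensRange, Proj.opensRange_awayι]
    exact hi
  have hI0 : Ideal.span (Set.range v) ≠ ⊥ := by
    intro h0
    have hyI : yb ∈ Ideal.span (Set.range v) := Ideal.subset_span ⟨0, rfl⟩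
    have hy0 : yb = 0 := by simpa [h0] using hyI
    obtain ⟨θ, h1, -, -⟩ := key _ (Sum.elim ![u₀, -(u₁ ^ 3 * u₀ ^ 2)] ![u₁ * u₀]) (by simp; ring)
    have h1' : θ yb = u₀ := by rw [h1]; rfl
    rw [hy0, map_zero] at h1'
    have hinj : Function.Injective (algebraMap (MvPolynomial (Fin 2) k)
        (Localization.Away (MvPolynomial.X 0 : MvPolynomial (Fin 2) k))) :=
      IsLocalization.injective _ (powers_le_nonZeroDivisors_of_noZeroDivisors (X_ne_zero 0))
    exact X_ne_zero (R := k) (0 : Fin 2) (hinj (by rw [map_zero]; exact h1'.symm))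
  exact ⟨_, affineBlowup.π _, affineBlowup.isResolution hI0 hreg⟩

end ConeCube

/-- **The `A₂` singularity, a singular member of the residual class, resolved**: `Σ(x³)` is not
regular (`suspension_not_isRegular`, `x³ ∈ (x)²`) and has a resolution (`hasResolution_coneCube`). -/
theorem coneCube_singular_hasResolution (k : Type) [Field k] (p : ℕ) [Fact p.Prime] [CharP k p] :
    ¬ Scheme.IsRegular (Spec (CommRingCat.of (MvPolynomial (Fin 2 ⊕ Fin 1) k ⧸ Ideal.span
      {(MvPolynomial.X (Sum.inl 0) * MvPolynomial.X (Sum.inl 1) +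
        MvPolynomial.rename Sum.inr (MvPolynomial.X 0 ^ 3) : MvPolynomial (Fin 2 ⊕ Fin 1) k)}))) ∧
    Scheme.HasResolution (Spec (CommRingCat.of (MvPolynomial (Fin 2 ⊕ Fin 1) k ⧸ Ideal.span
      {(MvPolynomial.X (Sum.inl 0) * MvPolynomial.X (Sum.inl 1) +
        MvPolynomial.rename Sum.inr (MvPolynomial.X 0 ^ 3) : MvPolynomial (Fin 2 ⊕ Fin 1) k)}))) :=
  ⟨suspension_not_isRegular k 1 (MvPolynomial.X 0 ^ 3) p (pow_ne_zero _ (MvPolynomial.X_ne_zero 0))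
    (Ideal.pow_le_pow_right (by norm_num)
      (Ideal.pow_mem_pow (Ideal.subset_span (Set.mem_range_self 0)) 3)),
    hasResolution_coneCube k⟩

end Summit.ResolutionOfSingularities.ResolutionOfSingularities.Theorems.FRationalResolution

end
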